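import Literature.NumberTheory.CubicFields.HessianCovariant
import Mathlib.NumberTheory.Modular
import HarnessLib

/-!
# Hessian reduction of integral binary cubic forms of positive discriminant

`Proofs` file (theorems only), topic `Literature/NumberTheory/CubicFields`, continuing
`HessianCovariant.lean`: Davenport's reduction theory for integral binary cubic forms
`f = a u³ + b u²v + c uv² + d v³` of POSITIVE discriminant (H. Davenport, *On the class-number of
binary cubic forms I*, J. London Math. Soc. 26 (1951); Belabas 1997 §3; BST 2013 §5.1).

* `exists_gl2zEquiv_hessianReduced` — **every integral form with `Disc > 0` is `GL₂(ℤ)`-equivalent to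
  a Hessian-reduced one**: `|Q| ≤ P ≤ R` for the Hessian `(P, Q, R) = (b² − 3ac, bc − 9ad, c² − 3bd)`
  (move the root of the positive definite Hessian into the modular fundamental domain, Mathlib's
  `ModularGroup.exists_smul_mem_fd`, through the equivariance `smul_hessianRoot_subst`);
* the classical inequalities for a Hessian-reduced form (`P > 0`, `|Q| ≤ P ≤ R`):
  `b² + 9a² ≤ P + 3|a||b|` (`sq_add_le_of_reduced`), hence `27a² ≤ 4P` and `(2|b| − 3|a|)² ≤ 4P`;
  `P² ≤ Disc` (`hessP_sq_le_disc`); and the syzygy `W² = 4P³ − 27a² Disc` for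
  `W = 2bP − 3aQ = 2b³ − 9abc + 27a²d` with `|2bP − W| = 3|a||Q| ≤ 3|a|P` — the input of the `O(X)`
  count of reduced forms (`DavenportBoundPos.lean`).

## References

* H. Davenport, *On the class-number of binary cubic forms I*, J. London Math. Soc. 26 (1951)
  183–192, Lemma 1 [Davenport1951CubicFormsI].
* K. Belabas, *A fast algorithm to compute cubic fields*, Math. Comp. 66 (1997), §3 [Belabas1997].
* M. Bhargava, A. Shankar, J. Tsimerman, *On the Davenport–Heilbronn theorems and second order terms*,
  Invent. Math. 193 (2013), §5.1 [BhargavaShankarTsimerman2012].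
-/

noncomputable section

open scoped MatrixGroups UpperHalfPlane

namespace Literature.NumberTheory.CubicFields

namespace BinaryCubic

/-! ### Small algebraic lemmas -/

section CommRing

variable {R S : Type*} [CommRing R] [CommRing S] (φ : R →+* S) (f : BinaryCubic R)

/-- `P` commutes with change of ring. [folklore] -/
@[simp] theorem hessP_map : (f.map φ).hessP = φ f.hessP := by
  simp [hessP, map_sub, map_mul, map_pow, map_ofNat]

/-- `Q` commutes with change of ring. [folklore] -/
@[simp] theorem hessQ_map : (f.map φ).hessQ = φ f.hessQ := by
  simp [hessQ, map_sub, map_mul, map_ofNat]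

/-- `R` commutes with change of ring. [folklore] -/
@[simp] theorem hessR_map : (f.map φ).hessR = φ f.hessR := by
  simp [hessR, map_sub, map_mul, map_pow, map_ofNat]

/-- `9a² R = P² − b² P + 3ab Q`. [folklore] -/
theorem nine_mul_sq_mul_hessR : 9 * f.a ^ 2 * f.hessR = f.hessP ^ 2 - f.b ^ 2 * f.hessP + 3 * f.a * f.b * f.hessQ := by
  simp only [hessP, hessQ, hessR]; ring

/-- `2bP − 3aQ = 2b³ − 9abc + 27a²d`. [folklore] -/
theorem two_b_hessP_sub : 2 * f.b * f.hessP - 3 * f.a * f.hessQ = 2 * f.b ^ 3 - 9 * f.a * f.b * f.c + 27 * f.a ^ 2 * f.d := by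
  simp only [hessP, hessQ]; ring

/-- The syzygy at `(1,0)` in the form `W² = 4P³ − 27 a² Disc`, `W = 2bP − 3aQ`. [folklore] -/
theorem sq_two_b_hessP_sub : (2 * f.b * f.hessP - 3 * f.a * f.hessQ) ^ 2 = 4 * f.hessP ^ 3 - 27 * f.a ^ 2 * f.disc := by
  have h := f.syzygy_one_zero
  have : (2 * f.b * f.hessP - 3 * f.a * f.hessQ) ^ 2 = (3 * f.a * f.hessQ - 2 * f.b * f.hessP) ^ 2 := by ring
  rw [this, h]
  ring

/-- The leading coefficient of `f ∘ γ` is the value `f(γ₀₀, γ₀₁)`. [folklore] -/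
theorem subst_a (γ : Matrix (Fin 2) (Fin 2) R) : (f.subst γ).a = f.eval (γ 0 0) (γ 0 1) := by
  simp only [subst, eval]

end CommRing

/-! ### The root of the Hessian and the modular fundamental domain -/

section Real

variable (F : BinaryCubic ℝ)

/-- `Re z(F) = −Q/(2P)`. [folklore] -/
theorem re_hessianRoot (h : 0 < F.disc) : (F.hessianRoot h).re = -F.hessQ / (2 * F.hessP) := by
  rw [← UpperHalfPlane.coe_re, F.coe_hessianRoot h]
  have hP : (F.hessP : ℂ) ≠ 0 := Complex.ofReal_ne_zero.mpr (F.hessP_pos_of_disc_pos h).ne'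
  have h2 : (2 * (F.hessP : ℂ)) = ((2 * F.hessP : ℝ) : ℂ) := by push_cast; ring
  rw [h2, Complex.div_ofReal_re]
  simp

/-- `|z(F)|² = R/P` (from `Q² − 4PR = −3 Disc`). [folklore] -/
theorem normSq_hessianRoot (h : 0 < F.disc) :
    Complex.normSq (F.hessianRoot h : ℂ) = F.hessR / F.hessP := by
  have hP := F.hessP_pos_of_disc_pos h
  rw [F.coe_hessianRoot h]
  have h2 : (2 * (F.hessP : ℂ)) = ((2 * F.hessP : ℝ) : ℂ) := by push_cast; ring
  rw [h2, Complex.normSq_div, Complex.normSq_ofReal]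
  have hnum : Complex.normSq (-(F.hessQ : ℂ) + Complex.I * (Real.sqrt (3 * F.disc) : ℂ)) =
      F.hessQ ^ 2 + 3 * F.disc := by
    rw [Complex.normSq_apply]
    simp only [Complex.add_re, Complex.neg_re, Complex.ofReal_re, Complex.mul_re, Complex.I_re, zero_mul,
      Complex.I_im, Complex.ofReal_im, mul_zero, sub_zero, add_zero, Complex.add_im, Complex.neg_im,
      neg_zero, Complex.mul_im, one_mul, zero_add]
    have hs : Real.sqrt (3 * F.disc) * Real.sqrt (3 * F.disc) = 3 * F.disc :=
      Real.mul_self_sqrt (by positivity)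
    nlinarith [hs]
  rw [hnum]
  have hsyz := F.hessQ_sq_sub_four_mul
  have hPR : F.hessQ ^ 2 + 3 * F.disc = 4 * F.hessP * F.hessR := by linarith
  rw [hPR]
  field_simp
  ring

end Real

/-! ### Reduction -/

/-- **Hessian reduction (Davenport 1951 I).** Every integral binary cubic form of positive discriminant
is `GL₂(ℤ)`-equivalent to a form whose (positive definite) Hessian `(P, Q, R)` is reduced:
`|Q| ≤ P ≤ R`.  Move the root `z(f) ∈ ℍ` of the Hessian into the standard fundamental domain by
`g ∈ SL₂(ℤ)` (Mathlib `ModularGroup.exists_smul_mem_fd`); by equivariance (`smul_hessianRoot_subst`)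
`z(f ∘ γ) = g • z(f)` for `γ = (g⁻¹)ᵀ`, and `|Re z| ≤ ½`, `|z| ≥ 1` read `|Q| ≤ P`, `P ≤ R`
(`Re z = −Q/2P`, `|z|² = R/P`). [cite: Davenport1951CubicFormsI, §2] -/
theorem exists_gl2zEquiv_hessianReduced (f : BinaryCubic ℤ) (h : 0 < f.disc) :
    ∃ g : BinaryCubic ℤ, GL2ZEquiv f g ∧ |g.hessQ| ≤ g.hessP ∧ g.hessP ≤ g.hessR := by
  classical
  set fR : BinaryCubic ℝ := f.map (Int.castRingHom ℝ) with hfR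
  have hR : 0 < fR.disc := by rw [hfR, disc_map, eq_intCast]; exact_mod_cast h
  set z : ℍ := fR.hessianRoot hR with hz
  obtain ⟨g₀, hg₀⟩ := ModularGroup.exists_smul_mem_fd z
  set γ : Matrix (Fin 2) (Fin 2) ℤ := ((g₀⁻¹ : SL(2, ℤ)) : Matrix (Fin 2) (Fin 2) ℤ).transpose with hγ
  have hγdet : γ.det = 1 := by
    rw [hγ, Matrix.det_transpose]; exact (g₀⁻¹).det_coe
  set g : BinaryCubic ℤ := f.subst γ with hgdef
  have hequiv : GL2ZEquiv f g :=
    ⟨γ, by rw [hγdet]; exact isUnit_one, by rw [twist, hγdet, one_smul]⟩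
  -- the real picture
  set γR : Matrix (Fin 2) (Fin 2) ℝ := γ.map (Int.castRingHom ℝ) with hγR
  have hγRdet : γR.det = 1 := by
    have : γR = (Int.castRingHom ℝ).mapMatrix γ := rfl
    rw [this, ← RingHom.map_det, hγdet, map_one]
  have hγRne : γR.det ≠ 0 := by rw [hγRdet]; exact one_ne_zero
  have hgR : g.map (Int.castRingHom ℝ) = fR.subst γR := by rw [hgdef, map_subst]
  have hgdisc : 0 < (fR.subst γR).disc := fR.disc_subst_pos hγRne hR
  -- equivariance: `G • z(f ∘ γ) = z(f)` with `G = γᵀ = g₀⁻¹`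
  have key := fR.smul_hessianRoot_subst (γ := γR) hγRne hR
  set w : ℍ := (fR.subst γR).hessianRoot (fR.disc_subst_pos hγRne hR) with hw
  set G : GL (Fin 2) ℝ := Matrix.GeneralLinearGroup.mkOfDetNeZero γR.transpose
    (by rwa [Matrix.det_transpose]) with hG
  have hprod : Matrix.SpecialLinearGroup.mapGL ℝ g₀ * G = 1 := by
    apply Units.ext
    change (Matrix.SpecialLinearGroup.mapGL ℝ g₀ : Matrix (Fin 2) (Fin 2) ℝ) * γR.transpose = 1
    rw [Matrix.SpecialLinearGroup.mapGL_coe_matrix, Matrix.SpecialLinearGroup.map_apply_coe,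
      RingHom.mapMatrix_apply, hγR, hγ, Matrix.transpose_map, Matrix.transpose_transpose]
    have : ((g₀⁻¹ : SL(2, ℤ)) : Matrix (Fin 2) (Fin 2) ℤ).map (Int.castRingHom ℝ) =
        ((g₀⁻¹ : SL(2, ℤ)) : Matrix (Fin 2) (Fin 2) ℤ).map (algebraMap ℤ ℝ) := rfl
    rw [this, ← Matrix.map_mul, ← Matrix.SpecialLinearGroup.coe_mul, mul_inv_cancel,
      Matrix.SpecialLinearGroup.coe_one, Matrix.map_one _ (map_zero _) (map_one _)]
  have hwz : w = g₀ • z := by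
    have h1 : Matrix.SpecialLinearGroup.mapGL ℝ g₀ • (G • w) = g₀ • z := by
      rw [key]; rfl
    rw [← mul_smul, hprod, one_smul] at h1
    exact h1
  -- membership in the fundamental domain
  have hfd : w ∈ ModularGroup.fd := hwz ▸ hg₀
  obtain ⟨hnorm, hre⟩ := hfd
  have hPpos : 0 < (fR.subst γR).hessP := (fR.subst γR).hessP_pos_of_disc_pos hgdisc
  rw [hw, normSq_hessianRoot] at hnorm
  rw [hw, re_hessianRoot] at hre
  -- back to integers
  have hP' : (fR.subst γR).hessP = (g.hessP : ℝ) := by rw [← hgR, hessP_map]; rfl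
  have hQ' : (fR.subst γR).hessQ = (g.hessQ : ℝ) := by rw [← hgR, hessQ_map]; rfl
  have hR' : (fR.subst γR).hessR = (g.hessR : ℝ) := by rw [← hgR, hessR_map]; rfl
  rw [hP', hR'] at hnorm
  rw [hP', hQ'] at hre
  rw [hP'] at hPpos
  refine ⟨g, hequiv, ?_, ?_⟩
  · -- `|−Q/(2P)| ≤ 1/2 ⇒ |Q| ≤ P`
    have h1 : |(g.hessQ : ℝ)| ≤ (g.hessP : ℝ) := by
      rw [abs_div, abs_neg, abs_of_pos (by positivity : (0 : ℝ) < 2 * g.hessP),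
        div_le_iff₀ (by positivity)] at hre
      linarith
    exact_mod_cast h1
  · -- `1 ≤ R/P ⇒ P ≤ R`
    have h1 : (g.hessP : ℝ) ≤ (g.hessR : ℝ) := by
      rw [le_div_iff₀ hPpos] at hnorm
      linarith
    exact_mod_cast h1

/-! ### Inequalities for Hessian-reduced forms -/

section Reduced

variable {f : BinaryCubic ℤ} (hP : 0 < f.hessP) (hQ : |f.hessQ| ≤ f.hessP) (hR : f.hessP ≤ f.hessR)

include hP hQ hR in
/-- **`b² + 9a² ≤ P + 3|a||b|`** for a Hessian-reduced form (`9a²P ≤ 9a²R = P² − b²P + 3abQ ≤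
P² − b²P + 3|a||b|P`). [cite: Davenport1951CubicFormsI, Lemma 1] -/
theorem sq_add_le_of_reduced : f.b ^ 2 + 9 * f.a ^ 2 ≤ f.hessP + 3 * |f.a| * |f.b| := by
  have h1 : 9 * f.a ^ 2 * f.hessP ≤ 9 * f.a ^ 2 * f.hessR :=
    mul_le_mul_of_nonneg_left hR (by positivity)
  rw [f.nine_mul_sq_mul_hessR] at h1
  have h2 : 3 * f.a * f.b * f.hessQ ≤ 3 * |f.a| * |f.b| * f.hessP := by
    have : |3 * f.a * f.b * f.hessQ| = 3 * |f.a| * |f.b| * |f.hessQ| := by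
      rw [abs_mul, abs_mul, abs_mul]; norm_num
    calc 3 * f.a * f.b * f.hessQ ≤ |3 * f.a * f.b * f.hessQ| := le_abs_self _
      _ = 3 * |f.a| * |f.b| * |f.hessQ| := this
      _ ≤ 3 * |f.a| * |f.b| * f.hessP := mul_le_mul_of_nonneg_left hQ (by positivity)
  have h3 : 9 * f.a ^ 2 * f.hessP ≤ (f.hessP - f.b ^ 2 + 3 * |f.a| * |f.b|) * f.hessP := by nlinarith
  have h4 := le_of_mul_le_mul_right h3 hP
  linarith

include hP hQ hR in
/-- **`27a² ≤ 4P`** for a Hessian-reduced form (`4(b² − 3|a||b| + 9a²) = (2|b| − 3|a|)² + 27a²`).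
[cite: Davenport1951CubicFormsI, Lemma 1] -/
theorem sq_a_le_of_reduced : 27 * f.a ^ 2 ≤ 4 * f.hessP := by
  have h := sq_add_le_of_reduced hP hQ hR
  nlinarith [sq_nonneg (2 * |f.b| - 3 * |f.a|), sq_abs f.a, sq_abs f.b]

include hP hQ hR in
/-- **`(2|b| − 3|a|)² ≤ 4P`** for a Hessian-reduced form. [cite: Davenport1951CubicFormsI, Lemma 1] -/
theorem sq_b_le_of_reduced : (2 * |f.b| - 3 * |f.a|) ^ 2 ≤ 4 * f.hessP := by
  have h := sq_add_le_of_reduced hP hQ hR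
  nlinarith [sq_nonneg f.a, sq_abs f.a, sq_abs f.b]

include hQ hR in
/-- **`P² ≤ Disc`** for a Hessian-reduced form (`4P² ≤ 4PR = Q² + 3 Disc ≤ P² + 3 Disc`). [cite: Davenport1951CubicFormsI, Lemma 1] -/
theorem hessP_sq_le_disc (hP0 : 0 ≤ f.hessP) : f.hessP ^ 2 ≤ f.disc := by
  have hsyz := f.hessQ_sq_sub_four_mul
  have hQ2 : f.hessQ ^ 2 ≤ f.hessP ^ 2 := by
    rw [← sq_abs f.hessQ]
    exact pow_le_pow_left₀ (abs_nonneg _) hQ 2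
  have hPR : f.hessP * f.hessP ≤ f.hessP * f.hessR := mul_le_mul_of_nonneg_left hR hP0
  nlinarith

end Reduced

end BinaryCubic

end Literature.NumberTheory.CubicFields

end
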